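import Mathlib.Analysis.SpecialFunctions.Pow.Real
import Mathlib.Data.Finset.Lattice.Fold
import Mathlib.Data.Fintype.Basic
import Literature.Computability.QuantumComplexity.GroverSearchLowerBound

/-!
# Estimating the top eigenvalue from sparse-access queries needs `Ω(√n)` quantum queries (DEQ-A1429)

Cell pub-qadeq, register row A-1429 / §1 OPEN-1282 (record `DEQ-A1429.md`). Honest framing:
instance-level adjudication of specific advantage claims; no claim about BQP vs BPP or the summit.

N. A. Nghiem, H. Sukeno, S. Zhang, T.-C. Wei, *Improved quantum power method and numerical
integration using a quantum singular-value transformation*, Phys. Rev. A **111**, 012434 (2025)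
(arXiv:2407.11744), Theorem 1: "Given oracle access to an s-sparse Hermitian matrix `A` with
conditional number `κ`" (spectrum in `[1/κ, 1]`, Sec. 2), the quantum power method with `k`
iterations runs in `O((s/ε) · k · (log n + log^{2.5}(sk/ε)) · log(1/ε))`, and with
`k = log(1/ε) + ½ log n` the running time for an `ε`-additive estimate of `λ_max` is
"polylogarithmic in `n` … superpolynomial speedup with respect to the dimension `n`" (Sec. 2,
after Theorem 1).

This file records the query floor every such algorithm must respect, on an input family INSIDE
the theorem's own class:

* `diagEntry z i = if z i then 1 else 1/2` — the diagonal (hence `1`-sparse, Hermitian) matrix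
  `A_z = diag(½ + z_i/2)` presented by the bit string `z : Fin n → Bool`; every entry lies in
  `[1/2, 1]` (`half_le_diagEntry`, `diagEntry_le_one`), i.e. the spectrum is in `[1/κ, 1]` with
  `κ = 2`, and one sparse-access query (row `i`: its single nonzero column is `i`, value
  `diagEntry z i`) is answered by ONE query to the bit `z i`.
* `lambdaMax z` — the largest diagonal entry = the largest eigenvalue of the diagonal matrix;
  `lambdaMax_eq_one_iff` / `lambdaMax_eq_half_iff`: it is `1` iff some bit is set and `1/2` iff
  none is, i.e. `λ_max(A_z) = ½ + OR(z)/2`.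
* `orFn_eq_decide_of_estimate` — ANY real number `e` with `|e - λ_max(A_z)| < 1/4` decides
  `OR_n(z)` (as `decide (3/4 < e)`).  So an algorithm that outputs an `ε`-additive estimate of
  `λ_max` with `ε < 1/4` and error probability `≤ 1/3` from `T` sparse-access queries is a
  `T`-query bounded-error algorithm for `OR_n`.
* `topEigenvalue_query_floor` — `√n ≤ 4 · Q₂(OR_n)` (Bennett–Bernstein–Brassard–Vazirani 1997 /
  Beals–Buhrman–Cleve–Mosca–de Wolf 2001 Thm 4.13, PROVED in the tree:
  `Literature.Computability.QuantumComplexity.sqrt_le_four_mul_quantumQueryComplexity_orFn`):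
  every bounded-error quantum algorithm for `OR_n` makes `≥ √n/4` queries — hence so does every
  `ε < 1/4` top-eigenvalue estimator on this family: `Ω(√n)`, not polylogarithmic in `n`.
* `floor_exceeds_log_cube` — the floor is not `O(polylog n)` numerically either: at `n = 2^40`,
  `(log₂ n)^3 = 64000 < 262144 = √n/4 ≤ Q₂(OR_n)`.

What is NOT claimed here: nothing about WHICH step of the paper's Sec. 2 fails (the record
`DEQ-A1429.md` locates it: Lemma 5 = [GSLW19, Thm 56] requires a Hermitian block-encoded matrix
and is applied to the rank-one non-Hermitian `ζ_k |x_k⟩⟨x_0|`; the heralded register state is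
`|x_0⟩`, not `|x_k⟩` — toy T-A1429); nothing about the numerical-integration half of the paper;
no statement about BQP vs BPP.
-/

namespace Summit.QuantumAdvantage.Dequantization.TopEigenvalueQueryFloor

open Literature.Computability.QuantumComplexity Literature.Computability.Cryptography

variable {n : ℕ}

/-! ### The diagonal family `A_z = diag(½ + z_i/2)` -/

/-- Diagonal entry `i` of `A_z`: `1` if the bit `z i` is set, `1/2` otherwise. -/
noncomputable def diagEntry (z : Fin n → Bool) (i : Fin n) : ℝ := if z i then 1 else 1 / 2

/-- A set bit gives the entry `1`. -/
theorem diagEntry_of_true {z : Fin n → Bool} {i : Fin n} (h : z i = true) : diagEntry z i = 1 := by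
  simp [diagEntry, h]

/-- An unset bit gives the entry `1/2`. -/
theorem diagEntry_of_false {z : Fin n → Bool} {i : Fin n} (h : z i = false) :
    diagEntry z i = 1 / 2 := by
  simp [diagEntry, h]

/-- Every entry is `≥ 1/2` … -/
theorem half_le_diagEntry (z : Fin n → Bool) (i : Fin n) : 1 / 2 ≤ diagEntry z i := by
  unfold diagEntry; split_ifs <;> norm_num

/-- … and `≤ 1`: the spectrum of the diagonal matrix `A_z` lies in `[1/κ, 1]` with `κ = 2`. -/
theorem diagEntry_le_one (z : Fin n → Bool) (i : Fin n) : diagEntry z i ≤ 1 := by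
  unfold diagEntry; split_ifs <;> norm_num

/-- The largest eigenvalue of the diagonal matrix `A_z` = its largest diagonal entry (`n ≥ 1`). -/
noncomputable def lambdaMax [NeZero n] (z : Fin n → Bool) : ℝ :=
  Finset.univ.sup' Finset.univ_nonempty (diagEntry z)

/-- Every diagonal entry is at most the largest one. -/
theorem diagEntry_le_lambdaMax [NeZero n] (z : Fin n → Bool) (i : Fin n) :
    diagEntry z i ≤ lambdaMax z :=
  Finset.le_sup' (diagEntry z) (Finset.mem_univ i)

/-- `λ_max(A_z) ≤ 1`. -/
theorem lambdaMax_le_one [NeZero n] (z : Fin n → Bool) : lambdaMax z ≤ 1 :=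
  Finset.sup'_le _ _ fun i _ => diagEntry_le_one z i

/-- `1/2 ≤ λ_max(A_z)`. -/
theorem half_le_lambdaMax [NeZero n] (z : Fin n → Bool) : 1 / 2 ≤ lambdaMax z :=
  (half_le_diagEntry z (0 : Fin n)).trans (diagEntry_le_lambdaMax z 0)

/-- **`λ_max(A_z) = 1` iff some bit of `z` is set** (`OR(z) = true`). -/
theorem lambdaMax_eq_one_iff [NeZero n] (z : Fin n → Bool) :
    lambdaMax z = 1 ↔ orFn n z = true := by
  rw [orFn_eq_true_iff]
  constructor
  · intro h
    obtain ⟨i, -, hi⟩ := Finset.exists_mem_eq_sup' Finset.univ_nonempty (diagEntry z)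
    refine ⟨i, ?_⟩
    by_contra hz
    have hf : z i = false := by simpa using hz
    have : lambdaMax z = 1 / 2 := by rw [lambdaMax, hi, diagEntry_of_false hf]
    linarith
  · rintro ⟨i, hi⟩
    exact le_antisymm (lambdaMax_le_one z) (by simpa [diagEntry_of_true hi] using diagEntry_le_lambdaMax z i)

/-- **`λ_max(A_z) = 1/2` iff no bit of `z` is set** (`OR(z) = false`). -/
theorem lambdaMax_eq_half_iff [NeZero n] (z : Fin n → Bool) :
    lambdaMax z = 1 / 2 ↔ orFn n z = false := by
  constructor
  · intro h
    by_contra hz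
    have ht : orFn n z = true := by simpa using hz
    have := (lambdaMax_eq_one_iff z).2 ht
    linarith
  · intro h
    refine le_antisymm (Finset.sup'_le _ _ fun i _ => ?_) (half_le_lambdaMax z)
    have hzi : z i = false := by
      by_contra hz'
      have hzt : z i = true := by simpa using hz'
      have ht : orFn n z = true := (orFn_eq_true_iff z).2 ⟨i, hzt⟩
      rw [h] at ht
      exact Bool.false_ne_true ht
    rw [diagEntry_of_false hzi]

/-- `λ_max(A_z) = ½ + OR(z)/2`. -/
theorem lambdaMax_eq [NeZero n] (z : Fin n → Bool) :
    lambdaMax z = if orFn n z then 1 else 1 / 2 := by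
  cases h : orFn n z
  · simpa using (lambdaMax_eq_half_iff z).2 h
  · simpa using (lambdaMax_eq_one_iff z).2 h

/-- **Any `1/4`-accurate estimate of `λ_max(A_z)` decides `OR_n(z)`**: if `|e - λ_max| < 1/4`
then `OR(z) = [e > 3/4]`.  Hence a `T`-query, error-`≤ 1/3`, `ε < 1/4` estimator of the top
eigenvalue (each sparse-access query to `A_z` being one query to `z`) is a `T`-query
bounded-error algorithm for `OR_n`. -/
theorem orFn_eq_decide_of_estimate [NeZero n] (z : Fin n → Bool) (e : ℝ)
    (he : |e - lambdaMax z| < 1 / 4) : orFn n z = decide (3 / 4 < e) := by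
  rw [abs_sub_lt_iff] at he
  obtain ⟨h1, h2⟩ := he
  cases h : orFn n z
  · have hl : lambdaMax z = 1 / 2 := (lambdaMax_eq_half_iff z).2 h
    rw [hl] at h1 h2
    have : ¬ (3 / 4 : ℝ) < e := by linarith
    simp [this]
  · have hl : lambdaMax z = 1 := (lambdaMax_eq_one_iff z).2 h
    rw [hl] at h1 h2
    have : (3 / 4 : ℝ) < e := by linarith
    simp [this]

/-! ### The query floor -/

/-- **Query floor for top-eigenvalue estimation.** Every bounded-error (error `≤ 1/3`) quantum
query algorithm for `OR_n` — in particular (by `orFn_eq_decide_of_estimate`) every algorithm that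
estimates `λ_max` of the `1`-sparse Hermitian matrices `A_z` (spectrum in `[1/2, 1]`) to additive
error `< 1/4` from sparse-access queries — makes at least `√n / 4` queries:
`√n ≤ 4 · Q₂(OR_n)` (Bennett–Bernstein–Brassard–Vazirani 1997; Beals–Buhrman–Cleve–Mosca–de Wolf
2001, Thm 4.13 — PROVED in the tree as `sqrt_le_four_mul_quantumQueryComplexity_orFn`).  `Ω(√n)`
queries is incompatible with a total running time polylogarithmic in `n`. -/
theorem topEigenvalue_query_floor (hn : 1 ≤ n) :
    Real.sqrt n ≤ 4 * (quantumQueryComplexity (1 / 3) (orFn n) : ℝ) :=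
  sqrt_le_four_mul_quantumQueryComplexity_orFn hn

/-- **The floor is not polylogarithmic**: at `n = 2^40` one has `(log₂ n)^3 = 40^3 = 64000`,
while `√n / 4 = 2^18 = 262144 ≤ Q₂(OR_n)`; so `Q₂(OR_{2^40}) > 64000 = (log₂ n)^3`
(and the ratio `√n / polylog n` grows without bound). -/
theorem floor_exceeds_log_cube :
    (64000 : ℝ) < (quantumQueryComplexity (1 / 3) (orFn (2 ^ 40)) : ℝ) := by
  have h := topEigenvalue_query_floor (n := 2 ^ 40) (Nat.one_le_two_pow)
  have hs : Real.sqrt ((2 ^ 40 : ℕ) : ℝ) = 2 ^ 20 := by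
    rw [show ((2 ^ 40 : ℕ) : ℝ) = (2 ^ 20) ^ 2 by norm_num]
    exact Real.sqrt_sq (by norm_num)
  rw [hs] at h
  linarith

/-- `log₂ (2^40) = 40`, so `(log₂ n)^3 = 64000` at `n = 2^40` (the comparison value above). -/
theorem log_two_pow_40 : Nat.log 2 (2 ^ 40) = 40 :=
  Nat.log_pow (by norm_num) 40

end Summit.QuantumAdvantage.Dequantization.TopEigenvalueQueryFloor
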